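import Summits.QuantumFields.BalabanUV.T4Continuum.Spine.NE7.Targets

/-!
# BalabanUVNodes ∕ the K5 spine — THE CANONICAL WEIGHTS AND RATE of a term-class carrier bundle: the LEAST relative weight of the bad class
# (`wInf`), the LEAST relative shell weight (`wshInf`) and a CANONICAL core-matching rate (`deltaCan`), defined from the carriers alone, such
# that `RelWeightBound` ∕ `ShellWeightBound` ∕ `NE7.Core ∧ Summable` hold at SOME weights ∕ rate iff they hold at the canonical ones

Cell `pub-ymgap`, YM-PLAN Track A (HUMAN RULING D-0062; work-bound push D-0149); seat `pub-ymgap-dag-n20-d` (R134 (a) N20 NE7b s3) gen 28; filed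
`--kind proof --supports stmt-QuantumFields-20544 --as helper` (K3⁷); COUNT-NEUTRAL.  The real-analysis half of plan g78's WORD-CR13 («`crOfRecord₁₃ :
SpineReading₁₃CoPH 2` has ONE declarer = dag-n20-d»): a `SpineCarriers` bundle (`Thm/BalabanUVNodesClustersCore`) CARRIES the weight sequences `W`, `Wsh` and
the rate `δ` as FIELDS, and the K5 faces read them (`S_N20` ∕ `S_N21` ∕ `S_N19` ∕ `S_U4`, leaf D's `h20` ∕ `h21`); a reading OF RECORD must therefore pin them
WITHOUT pretending to know the estimate's outputs.  This file supplies the pin: the weights and the rate are DEFINED from `(l₀, vol, T, A, B, Bad, shA, shB)`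
as infima of the admissible values, and every witness transfers to them.

WHAT IS PROVED ([folklore] real analysis over the tree's shapes `T4WeightBudget.RelWeightBound` :117, `T4IndicatorShell.ShellWeightBound` :403,
`Spine.NE7.Core`; 0 `sorry`; the three `def`s are plain noncomputable real numbers):
* §1 `admW l₀ T A B Bad K` = the admissible relative weights of the bad class at step `K` (`0 ≤ w` and both runs' bad sums `≤ w ·` full sums for all
  `|t| ≤ l₀`) — CLOSED (an intersection of closed half-lines), bounded below by `0`; `wInf := sInf admW` is `≥ 0`, lies in `admW` as soon as `admW` is
  non-empty, and is `≤` every admissible weight; ★ `relWeightBound_wInf`: ANY witness `W` of `RelWeightBound l₀ T A B Bad W` transfers to `wInf` (so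
  `RelWeightBound … (wInf …) ↔ ∃ W, RelWeightBound … W`, `relWeightBound_wInf_iff`) — «THE relative weight of the bad class» is a definite sequence and
  NE7b's content at a reading is exactly `∀ K, wInf K < 1 ∧ Summable wInf`.
* §2 the same for the shell: `admWsh`, `wshInf`, ★ `shellWeightBound_wshInf`, `shellWeightBound_wshInf_iff`; and U4′'s `W + Wsh < 1` transfers
  (`wInf_add_wshInf_lt_one`).
* §3 the rate: `admD l₀ vol T Bad P Q K` = the admissible `d ≥ 0` of `NE7.Core` at step `K` (SOME `t`-independent constant `c` sandwiches `Q` between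
  `e^{c ∓ vol·d}·P` on the good classes); for non-negative cores `P` and `vol ≥ 0` it is UPWARD CLOSED, so `deltaCan := sInf admD + 2^{−K}` is admissible
  whenever anything is (no closedness of a projection needed); ★ `core_deltaCan` ∕ ★ `summable_deltaCan`: ANY `δ` with `Core … δ ∧ Summable δ` transfers
  (`|δ_K|` is admissible, `0 ≤ sInf admD ≤ |δ_K|`, plus a geometric series).
HONEST FRAMING: nothing of Bałaban's is asserted; no estimate is proved — every theorem is «a witness transfers to the canonical value»; NE7 ∕ NE7b ∕ NE7c
NOT PRINTED for d = 4 ∕ NOT proved; N19 ∕ N20 ∕ N21 ∕ N27 NOT discharged; counts UNMOVED (typed 28∕28 · discharged 5∕27); one finite four-torus programme at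
fixed `ε` — NOT ℝ⁴, NOT OS, NOT a mass gap, NOT the Clay problem.  No decl below carries a cite tag.
-/

noncomputable section

open scoped BigOperators
open Set

namespace Summit.QuantumFields.YangMills.BalabanUVNodes.SpineCanonicalWeights

open Literature.MathematicalPhysics.QuantumFieldTheory.Balaban1983to89
open T4WeightBudget (RelWeightBound)
open T4IndicatorShell (ShellWeightBound)
open Summit.QuantumFields.BalabanUV.T4Continuum.Spine

/-! ## §1 The least relative weight of the bad class -/

section Weight

variable {ι : Type*} (l₀ : ℝ) (T : ℕ → Finset ι) (A B : ℕ → ℝ → ι → ℝ) (Bad : ℕ → ℝ → Finset ι)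

/-- THE ADMISSIBLE RELATIVE WEIGHTS of the bad class at step `K`: `0 ≤ w` and, for every source `|t| ≤ l₀`, both runs' bad sums are at most `w` times the
full sums — the `K`-th slice of `RelWeightBound`'s `nonneg ∕ bad_left ∕ bad_right`. [folklore] -/
def admW (K : ℕ) : Set ℝ :=
  {w | 0 ≤ w ∧ ∀ t : ℝ, |t| ≤ l₀ →
    (∑ τ ∈ Bad K t, A K t τ ≤ w * ∑ τ ∈ T K, A K t τ) ∧ (∑ τ ∈ Bad K t, B K t τ ≤ w * ∑ τ ∈ T K, B K t τ)}

/-- **THE CANONICAL (LEAST) RELATIVE WEIGHT OF THE BAD CLASS** at step `K`: the infimum of the admissible weights (`0` if there is none). [folklore] -/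
def wInf (K : ℕ) : ℝ :=
  sInf (admW l₀ T A B Bad K)

/-- The admissible weights form a CLOSED set (an intersection of closed half-lines `{w | a ≤ w·b}` with `[0, ∞)`). [folklore] -/
theorem isClosed_admW (K : ℕ) : IsClosed (admW l₀ T A B Bad K) := by
  have h : admW l₀ T A B Bad K = Ici 0 ∩ ⋂ t : ℝ, ⋂ (_ : |t| ≤ l₀),
      ({w : ℝ | ∑ τ ∈ Bad K t, A K t τ ≤ w * ∑ τ ∈ T K, A K t τ} ∩ {w : ℝ | ∑ τ ∈ Bad K t, B K t τ ≤ w * ∑ τ ∈ T K, B K t τ}) := by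
    ext w
    simp only [admW, mem_setOf_eq, mem_inter_iff, mem_Ici, mem_iInter]
  rw [h]
  refine isClosed_Ici.inter (isClosed_iInter fun t => isClosed_iInter fun _ => IsClosed.inter ?_ ?_)
  · exact isClosed_le continuous_const (continuous_id.mul continuous_const)
  · exact isClosed_le continuous_const (continuous_id.mul continuous_const)

/-- The admissible weights are bounded below by `0`. [folklore] -/
theorem bddBelow_admW (K : ℕ) : BddBelow (admW l₀ T A B Bad K) :=
  ⟨0, fun _ hw => hw.1⟩

variable {l₀ T A B Bad}

/-- Every witness of `RelWeightBound` is admissible at every step. [folklore] -/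
theorem mem_admW_of_relWeightBound {W : ℕ → ℝ} (h : RelWeightBound l₀ T A B Bad W) (K : ℕ) : W K ∈ admW l₀ T A B Bad K :=
  ⟨h.nonneg K, fun t ht => ⟨h.bad_left K t ht, h.bad_right K t ht⟩⟩

/-- The canonical weight is non-negative. [folklore] -/
theorem wInf_nonneg (K : ℕ) : 0 ≤ wInf l₀ T A B Bad K := by
  by_cases hne : (admW l₀ T A B Bad K).Nonempty
  · exact le_csInf hne fun w hw => hw.1
  · rw [Set.not_nonempty_iff_eq_empty] at hne
    simp [wInf, hne, Real.sInf_empty]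

/-- The canonical weight is at most every admissible weight. [folklore] -/
theorem wInf_le_of_mem {K : ℕ} {w : ℝ} (hw : w ∈ admW l₀ T A B Bad K) : wInf l₀ T A B Bad K ≤ w :=
  csInf_le (bddBelow_admW l₀ T A B Bad K) hw

/-- The canonical weight is at most every witness of `RelWeightBound`. [folklore] -/
theorem wInf_le_of_relWeightBound {W : ℕ → ℝ} (h : RelWeightBound l₀ T A B Bad W) (K : ℕ) : wInf l₀ T A B Bad K ≤ W K :=
  wInf_le_of_mem (mem_admW_of_relWeightBound h K)

/-- If some weight is admissible at step `K`, the canonical weight IS admissible (the infimum of a closed bounded-below non-empty set is attained). [folklore] -/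
theorem wInf_mem_of_nonempty {K : ℕ} (hne : (admW l₀ T A B Bad K).Nonempty) : wInf l₀ T A B Bad K ∈ admW l₀ T A B Bad K :=
  (isClosed_admW l₀ T A B Bad K).csInf_mem hne (bddBelow_admW l₀ T A B Bad K)

/-- ★ **EVERY WITNESS OF `RelWeightBound` TRANSFERS TO THE CANONICAL WEIGHT.** [folklore] -/
theorem relWeightBound_wInf {W : ℕ → ℝ} (h : RelWeightBound l₀ T A B Bad W) : RelWeightBound l₀ T A B Bad (wInf l₀ T A B Bad) where
  bad_subset := h.bad_subset
  nonneg := wInf_nonneg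
  lt_one K := (wInf_le_of_relWeightBound h K).trans_lt (h.lt_one K)
  summable := Summable.of_nonneg_of_le wInf_nonneg (wInf_le_of_relWeightBound h) h.summable
  bad_left K t ht := ((wInf_mem_of_nonempty ⟨W K, mem_admW_of_relWeightBound h K⟩).2 t ht).1
  bad_right K t ht := ((wInf_mem_of_nonempty ⟨W K, mem_admW_of_relWeightBound h K⟩).2 t ht).2

/-- ★ **`RelWeightBound` HOLDS AT THE CANONICAL WEIGHT IFF IT HOLDS AT SOME WEIGHT** — NE7b at a carrier bundle is a statement about a DEFINITE sequence. [folklore] -/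
theorem relWeightBound_wInf_iff : RelWeightBound l₀ T A B Bad (wInf l₀ T A B Bad) ↔ ∃ W : ℕ → ℝ, RelWeightBound l₀ T A B Bad W :=
  ⟨fun h => ⟨_, h⟩, fun ⟨_, h⟩ => relWeightBound_wInf h⟩

end Weight

/-! ## §2 The least relative shell weight -/

section Shell

variable {ι : Type*} (l₀ : ℝ) (T : ℕ → Finset ι) (A B shA shB : ℕ → ℝ → ι → ℝ)

/-- THE ADMISSIBLE RELATIVE SHELL WEIGHTS at step `K`: `0 ≤ w` and, for every `|t| ≤ l₀`, both runs' total shell parts are at most `w` times the full sums —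
the `K`-th slice of `ShellWeightBound`'s `nonneg ∕ left ∕ right`. [folklore] -/
def admWsh (K : ℕ) : Set ℝ :=
  {w | 0 ≤ w ∧ ∀ t : ℝ, |t| ≤ l₀ →
    (∑ τ ∈ T K, shA K t τ ≤ w * ∑ τ ∈ T K, A K t τ) ∧ (∑ τ ∈ T K, shB K t τ ≤ w * ∑ τ ∈ T K, B K t τ)}

/-- **THE CANONICAL (LEAST) RELATIVE SHELL WEIGHT** at step `K`. [folklore] -/
def wshInf (K : ℕ) : ℝ :=
  sInf (admWsh l₀ T A B shA shB K)

/-- The admissible shell weights form a closed set. [folklore] -/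
theorem isClosed_admWsh (K : ℕ) : IsClosed (admWsh l₀ T A B shA shB K) := by
  have h : admWsh l₀ T A B shA shB K = Ici 0 ∩ ⋂ t : ℝ, ⋂ (_ : |t| ≤ l₀),
      ({w : ℝ | ∑ τ ∈ T K, shA K t τ ≤ w * ∑ τ ∈ T K, A K t τ} ∩ {w : ℝ | ∑ τ ∈ T K, shB K t τ ≤ w * ∑ τ ∈ T K, B K t τ}) := by
    ext w
    simp only [admWsh, mem_setOf_eq, mem_inter_iff, mem_Ici, mem_iInter]
  rw [h]
  refine isClosed_Ici.inter (isClosed_iInter fun t => isClosed_iInter fun _ => IsClosed.inter ?_ ?_)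
  · exact isClosed_le continuous_const (continuous_id.mul continuous_const)
  · exact isClosed_le continuous_const (continuous_id.mul continuous_const)

/-- The admissible shell weights are bounded below by `0`. [folklore] -/
theorem bddBelow_admWsh (K : ℕ) : BddBelow (admWsh l₀ T A B shA shB K) :=
  ⟨0, fun _ hw => hw.1⟩

variable {l₀ T A B shA shB}

/-- Every witness of `ShellWeightBound` is admissible at every step. [folklore] -/
theorem mem_admWsh_of_shellWeightBound {Wsh : ℕ → ℝ} (h : ShellWeightBound l₀ T A B shA shB Wsh) (K : ℕ) :
    Wsh K ∈ admWsh l₀ T A B shA shB K :=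
  ⟨h.nonneg K, fun t ht => ⟨h.left K t ht, h.right K t ht⟩⟩

/-- The canonical shell weight is non-negative. [folklore] -/
theorem wshInf_nonneg (K : ℕ) : 0 ≤ wshInf l₀ T A B shA shB K := by
  by_cases hne : (admWsh l₀ T A B shA shB K).Nonempty
  · exact le_csInf hne fun w hw => hw.1
  · rw [Set.not_nonempty_iff_eq_empty] at hne
    simp [wshInf, hne, Real.sInf_empty]

/-- The canonical shell weight is at most every witness of `ShellWeightBound`. [folklore] -/
theorem wshInf_le_of_shellWeightBound {Wsh : ℕ → ℝ} (h : ShellWeightBound l₀ T A B shA shB Wsh) (K : ℕ) : wshInf l₀ T A B shA shB K ≤ Wsh K :=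
  csInf_le (bddBelow_admWsh l₀ T A B shA shB K) (mem_admWsh_of_shellWeightBound h K)

/-- If some shell weight is admissible at step `K`, the canonical one is. [folklore] -/
theorem wshInf_mem_of_nonempty {K : ℕ} (hne : (admWsh l₀ T A B shA shB K).Nonempty) : wshInf l₀ T A B shA shB K ∈ admWsh l₀ T A B shA shB K :=
  (isClosed_admWsh l₀ T A B shA shB K).csInf_mem hne (bddBelow_admWsh l₀ T A B shA shB K)

/-- ★ **EVERY WITNESS OF `ShellWeightBound` TRANSFERS TO THE CANONICAL SHELL WEIGHT** (the term-wise clauses do not involve the weight). [folklore] -/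
theorem shellWeightBound_wshInf {Wsh : ℕ → ℝ} (h : ShellWeightBound l₀ T A B shA shB Wsh) :
    ShellWeightBound l₀ T A B shA shB (wshInf l₀ T A B shA shB) where
  nonneg := wshInf_nonneg
  summable := Summable.of_nonneg_of_le wshInf_nonneg (wshInf_le_of_shellWeightBound h) h.summable
  sh_nonneg_left := h.sh_nonneg_left
  sh_le_left := h.sh_le_left
  sh_nonneg_right := h.sh_nonneg_right
  sh_le_right := h.sh_le_right
  left K t ht := ((wshInf_mem_of_nonempty ⟨Wsh K, mem_admWsh_of_shellWeightBound h K⟩).2 t ht).1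
  right K t ht := ((wshInf_mem_of_nonempty ⟨Wsh K, mem_admWsh_of_shellWeightBound h K⟩).2 t ht).2

/-- ★ `ShellWeightBound` holds at the canonical shell weight iff it holds at some weight. [folklore] -/
theorem shellWeightBound_wshInf_iff :
    ShellWeightBound l₀ T A B shA shB (wshInf l₀ T A B shA shB) ↔ ∃ Wsh : ℕ → ℝ, ShellWeightBound l₀ T A B shA shB Wsh :=
  ⟨fun h => ⟨_, h⟩, fun ⟨_, h⟩ => shellWeightBound_wshInf h⟩

/-- **U4′'s BOOKKEEPING TRANSFERS**: if some witnesses have `W K + Wsh K < 1`, so do the canonical weights (they are the least ones). [folklore] -/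
theorem wInf_add_wshInf_lt_one {Bad : ℕ → ℝ → Finset ι} {W Wsh : ℕ → ℝ} (hW : RelWeightBound l₀ T A B Bad W)
    (hSh : ShellWeightBound l₀ T A B shA shB Wsh) (hlt : ∀ K, W K + Wsh K < 1) (K : ℕ) :
    wInf l₀ T A B Bad K + wshInf l₀ T A B shA shB K < 1 :=
  (add_le_add (wInf_le_of_relWeightBound hW K) (wshInf_le_of_shellWeightBound hSh K)).trans_lt (hlt K)

end Shell

/-! ## §3 The canonical core-matching rate -/

section Rate

variable {ι : Type*} [DecidableEq ι] (l₀ vol : ℝ) (T : ℕ → Finset ι) (Bad : ℕ → ℝ → Finset ι) (P Q : ℕ → ℝ → ι → ℝ)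

/-- THE ADMISSIBLE RATES of `NE7.Core` at step `K`: `0 ≤ d` and SOME `t`-independent constant `c` sandwiches `Q` between `e^{c − vol·d}·P` and `e^{c + vol·d}·P` on
every good class `τ ∈ T K ∖ Bad K t`, `|t| ≤ l₀`. [folklore] -/
def admD (K : ℕ) : Set ℝ :=
  {d | 0 ≤ d ∧ ∃ c : ℝ, ∀ t : ℝ, |t| ≤ l₀ → ∀ τ ∈ T K \ Bad K t,
    Real.exp (c - vol * d) * P K t τ ≤ Q K t τ ∧ Q K t τ ≤ Real.exp (c + vol * d) * P K t τ}

/-- **THE CANONICAL CORE-MATCHING RATE**: the infimum of the admissible rates plus `2^{−K}` (a summable slack, so that no closedness of a projection is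
needed for attainment). [folklore] -/
def deltaCan (K : ℕ) : ℝ :=
  sInf (admD l₀ vol T Bad P Q K) + (1 / 2) ^ K

/-- The admissible rates are bounded below by `0`. [folklore] -/
theorem bddBelow_admD (K : ℕ) : BddBelow (admD l₀ vol T Bad P Q K) :=
  ⟨0, fun _ hd => hd.1⟩

variable {l₀ vol T Bad P Q}

/-- WIDENING: for non-negative cores `P` and `vol ≥ 0`, a sandwich at rate `d` is a sandwich at every rate `d' ≥ d` (same constant). [folklore] -/
theorem sandwich_mono (hvol : 0 ≤ vol) {c d d' p q : ℝ} (hp : 0 ≤ p) (hdd' : d ≤ d')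
    (h : Real.exp (c - vol * d) * p ≤ q ∧ q ≤ Real.exp (c + vol * d) * p) :
    Real.exp (c - vol * d') * p ≤ q ∧ q ≤ Real.exp (c + vol * d') * p := by
  have h1 : vol * d ≤ vol * d' := mul_le_mul_of_nonneg_left hdd' hvol
  constructor
  · exact (mul_le_mul_of_nonneg_right (Real.exp_le_exp.2 (by linarith)) hp).trans h.1
  · exact h.2.trans (mul_le_mul_of_nonneg_right (Real.exp_le_exp.2 (by linarith)) hp)

/-- The admissible rates are UPWARD CLOSED (non-negative cores, `vol ≥ 0`). [folklore] -/
theorem mem_admD_of_le (hvol : 0 ≤ vol) {K : ℕ} (hP : ∀ t : ℝ, |t| ≤ l₀ → ∀ τ ∈ T K \ Bad K t, 0 ≤ P K t τ) {d d' : ℝ}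
    (hd : d ∈ admD l₀ vol T Bad P Q K) (hdd' : d ≤ d') : d' ∈ admD l₀ vol T Bad P Q K := by
  obtain ⟨hd0, c, hc⟩ := hd
  exact ⟨hd0.trans hdd', c, fun t ht τ hτ => sandwich_mono hvol (hP t ht τ hτ) hdd' (hc t ht τ hτ)⟩

/-- A witness `δ` of `Core` gives the admissible rate `|δ K|` at every step (widen from `δ K` to `|δ K|`). [folklore] -/
theorem abs_mem_admD_of_core (hvol : 0 ≤ vol) (hP : ∀ (K : ℕ) (t : ℝ), |t| ≤ l₀ → ∀ τ ∈ T K \ Bad K t, 0 ≤ P K t τ) {δ : ℕ → ℝ}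
    (h : NE7.Core l₀ vol T Bad P Q δ) (K : ℕ) : |δ K| ∈ admD l₀ vol T Bad P Q K := by
  obtain ⟨c, hc⟩ := h K
  exact ⟨abs_nonneg _, c, fun t ht τ hτ => sandwich_mono hvol (hP K t ht τ hτ) (le_abs_self _) (hc t ht τ hτ)⟩

/-- The infimum of the admissible rates is non-negative. [folklore] -/
theorem sInf_admD_nonneg (K : ℕ) : 0 ≤ sInf (admD l₀ vol T Bad P Q K) := by
  by_cases hne : (admD l₀ vol T Bad P Q K).Nonempty
  · exact le_csInf hne fun d hd => hd.1
  · rw [Set.not_nonempty_iff_eq_empty] at hne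
    simp [hne, Real.sInf_empty]

/-- The canonical rate is positive (hence non-negative). [folklore] -/
theorem deltaCan_pos (K : ℕ) : 0 < deltaCan l₀ vol T Bad P Q K :=
  add_pos_of_nonneg_of_pos (sInf_admD_nonneg K) (by positivity)

/-- If some rate is admissible at step `K`, the canonical rate IS admissible (upward closure past a member below `sInf + 2^{−K}`). [folklore] -/
theorem deltaCan_mem_of_nonempty (hvol : 0 ≤ vol) {K : ℕ} (hP : ∀ t : ℝ, |t| ≤ l₀ → ∀ τ ∈ T K \ Bad K t, 0 ≤ P K t τ)
    (hne : (admD l₀ vol T Bad P Q K).Nonempty) : deltaCan l₀ vol T Bad P Q K ∈ admD l₀ vol T Bad P Q K := by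
  have hlt : sInf (admD l₀ vol T Bad P Q K) < deltaCan l₀ vol T Bad P Q K := lt_add_of_pos_right _ (by positivity)
  obtain ⟨d, hd, hdlt⟩ := exists_lt_of_csInf_lt hne hlt
  exact mem_admD_of_le hvol hP hd hdlt.le

/-- ★ **EVERY WITNESS OF `NE7.Core` TRANSFERS TO THE CANONICAL RATE** (non-negative cores, `vol ≥ 0`). [folklore] -/
theorem core_deltaCan (hvol : 0 ≤ vol) (hP : ∀ (K : ℕ) (t : ℝ), |t| ≤ l₀ → ∀ τ ∈ T K \ Bad K t, 0 ≤ P K t τ) {δ : ℕ → ℝ}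
    (h : NE7.Core l₀ vol T Bad P Q δ) : NE7.Core l₀ vol T Bad P Q (deltaCan l₀ vol T Bad P Q) := fun K =>
  (deltaCan_mem_of_nonempty hvol (hP K) ⟨_, abs_mem_admD_of_core hvol hP h K⟩).2

/-- ★ **… AND ITS SUMMABILITY TRANSFERS**: `0 ≤ sInf admD_K ≤ |δ_K|` and `Σ 2^{−K} < ∞`. [folklore] -/
theorem summable_deltaCan (hvol : 0 ≤ vol) (hP : ∀ (K : ℕ) (t : ℝ), |t| ≤ l₀ → ∀ τ ∈ T K \ Bad K t, 0 ≤ P K t τ) {δ : ℕ → ℝ}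
    (h : NE7.Core l₀ vol T Bad P Q δ) (hδ : Summable δ) : Summable (deltaCan l₀ vol T Bad P Q) := by
  refine Summable.add ?_ (summable_geometric_of_lt_one (by norm_num) (by norm_num))
  refine Summable.of_nonneg_of_le sInf_admD_nonneg (fun K => ?_) hδ.abs
  exact csInf_le (bddBelow_admD l₀ vol T Bad P Q K) (abs_mem_admD_of_core hvol hP h K)

/-- ★ `NE7.Core ∧ Summable` holds at the canonical rate iff it holds at some rate (non-negative cores, `vol ≥ 0`). [folklore] -/
theorem core_deltaCan_iff (hvol : 0 ≤ vol) (hP : ∀ (K : ℕ) (t : ℝ), |t| ≤ l₀ → ∀ τ ∈ T K \ Bad K t, 0 ≤ P K t τ) :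
    (NE7.Core l₀ vol T Bad P Q (deltaCan l₀ vol T Bad P Q) ∧ Summable (deltaCan l₀ vol T Bad P Q)) ↔
      ∃ δ : ℕ → ℝ, NE7.Core l₀ vol T Bad P Q δ ∧ Summable δ :=
  ⟨fun h => ⟨_, h⟩, fun ⟨_, h, hδ⟩ => ⟨core_deltaCan hvol hP h, summable_deltaCan hvol hP h hδ⟩⟩

/-- The non-negativity of the cores that §3 needs is what `ShellWeightBound` provides (`0 ≤ shA ≤ A` on every class, a fortiori on the good ones). [folklore] -/
theorem core_nonneg_of_shellWeightBound {A B shA shB : ℕ → ℝ → ι → ℝ} {Wsh : ℕ → ℝ} (h : ShellWeightBound l₀ T A B shA shB Wsh) :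
    ∀ (K : ℕ) (t : ℝ), |t| ≤ l₀ → ∀ τ ∈ T K \ Bad K t, 0 ≤ A K t τ - shA K t τ :=
  fun K t ht τ hτ => sub_nonneg.2 (h.sh_le_left K t ht τ (Finset.mem_sdiff.1 hτ).1)

end Rate

end Summit.QuantumFields.YangMills.BalabanUVNodes.SpineCanonicalWeights

end
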